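import Literature.NumberTheory.EllipticCurves.ComplexMultiplicationDeuringEndReductionProofs
import Literature.NumberTheory.EllipticCurves.ComplexMultiplicationDeuringReductionCMEndProofs
import HarnessLib

/-!
# Deuring's lifting of the Frobenius at a prime split in a CM order (any conductor)

Topic `NumberTheory/EllipticCurves`; a proofs-only file (theorems only, no definitions, no named
facts) over the tree's reduction of endomorphisms
(`Lang1987_exists_reduction_geomPoints_geomEndRing_holds`,
`exists_ringHom_geomEndRing_of_reduction`: Silverman, *Advanced Topics*, Prop. II.4.4), Deuring's
criterion at split primes (`WeierstrassCurve.exists_ne_zero_nsmul_eq_zero_of_cmEnd`: Lang,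
*Elliptic Functions*, Ch. 13 §4 Thm. 12) and the structure of the endomorphism ring of an ordinary
curve (`Lang1987_geomEndRing_isOrder_of_exists_pTorsion_holds`: Lang, Ch. 13 §2 Thm. 5).

It proves, for an *arbitrary* quadratic order `ℤ[ω] ⊆ End_{ℚ̄}(E)` (no class-number or
maximality hypothesis, in contrast with the nine-curve files `ComplexMultiplicationDeuringReduction*`),
the half of Deuring's reduction theorem (Deuring 1941; Lang, Ch. 13 §4 Thm. 12(ii) with Thm. 13:
*"there exists an endomorphism of `A` whose reduction is the Frobenius"*, *"`ℓ` cannot divide the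
conductor"*) that the tree needs in order to determine the class number of the complex
multiplication of a curve over `ℚ` by reduction modulo split primes. The order is written in
Cox's normal form `ω² − dω + c = 0`, `4c = d(d − 1)` (`ω ↔ (d + √d)/2`, discriminant `d`), as in
the sibling `ComplexMultiplicationDeuringReductionCMEndProofs`.

* `WeierstrassCurve.exists_natCast_mul_frobenius_eq_of_cmEnd` — **downstairs**: for an elliptic
  curve `V/𝔽_p` (`p` odd) with a geometric endomorphism `ω`, `ω² − dω + c = 0`, `d < 0`,
  `4c = d(d − 1)`, `p ∤ d`, `d` a square mod `p`, the `p`-Frobenius `π` satisfies `m π = u + v ω`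
  in `End_{𝔽̄_p}(V)` for some integers `u, v` and some `m ≥ 1` **prime to `p`** (`V` is ordinary,
  so `End_{𝔽̄_p}(V)` is an imaginary quadratic order containing `ℤ[ω]` and `π`; the index of `ℤ[ω]`
  in it is prime to `p` because `p ∤ d`: `WeierstrassCurve.dvd_and_dvd_of_natCast_mul_eq`);
* `exists_cmEnd_apply_torsion_eq_zero_natCard_ker` — **upstairs**: for `E/ℚ` given by a globally
  minimal `W` with `φ ∈ End_{ℚ̄}(E)`, `φ² − dφ + c = 0` as above, and a good odd prime `p ∤ d` with
  `d` a square mod `p`, there are integers `u, v` and `m ≥ 1`, `p ∤ m`, such that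
  `ρ = u + vφ ∈ End_{ℚ̄}(E)` kills `E[m]` and has `#ker ρ = m² p` — `ρ` reduces to `m π`
  (reduction is injective on `E[m]`, Silverman *AEC* VII.3.1(b), and preserves degrees,
  *AT* II.4.4). Analytically `ρ = m·x` with `x ∈ End(Λ)` of norm `p`: every good prime split in
  the CM field is a norm from the full order `End(Λ)` (consumed in the class-number-one argument
  for `hasCM_iff_j_mem`).

## References

* M. Deuring, *Die Typen der Multiplikatorenringe elliptischer Funktionenkörper*, Abh. Math. Sem.
  Univ. Hamburg 14 (1941), 197–272. [Deuring1941]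
* S. Lang, *Elliptic Functions*, 2nd ed., GTM 112 (1987): Ch. 13 §2 Thm. 5, §4 Thms. 12–13 (PDF
  pp. 134, 140–142). Held: `book:lang1987-elliptic-functions`. [Lang1987]
* J. H. Silverman, *Advanced Topics in the Arithmetic of Elliptic Curves*, GTM 151 (1994),
  Prop. II.4.4. [SilvermanAdvancedTopics1994]
* J. H. Silverman, *The Arithmetic of Elliptic Curves*, 2nd ed. (2009), Prop. VII.3.1(b),
  Cor. III.6.3. [SilvermanAEC2009]

## Design

`noncomputable section`, `open scoped Classical`; nothing is defined. Downstairs theorems are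
dot-notation extensions in `namespace WeierstrassCurve` (as in the sibling files), the upstairs
theorem lives in `Literature.NumberTheory.EllipticCurves`. `End_{K̄}(E)` carries only a `Ring`
instance; where it is known to be commutative (ordinary curves over finite fields, Lang Ch. 13 §2
Thm. 5; the tree's `geomEndRing_comm_of_exists_torsion_char`) the commutativity is passed as a
hypothesis `hcomm` and used through a local `CommRing` structure. The integer arithmetic of the
index argument is isolated in `WeierstrassCurve.dvd_and_dvd_of_sq_rel`.
-/

noncomputable section

open scoped Classical NumberField

universe u

namespace WeierstrassCurve

open Literature.NumberTheory.EllipticCurves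

variable {K : Type u} [Field K] {W : WeierstrassCurve K}

/-! ## Integer arithmetic of the index argument -/

/-- **The index of `ℤ[ω]` is prime to `p` when `p ∤ disc ℤ[ω]`** — the integer arithmetic: if
`u² − nv² − p t' u + p² d' = 0` and `2uv + tv² − p t' v = 0` (the two coordinates, on the basis
`1, ω` with `ω² = tω − n`, of `(u + vω)² = p t'(u + vω) − p² d'`) and `p` is a prime with
`p ∤ t² − 4n`, then `p ∣ u` and `p ∣ v`. [folklore] -/
theorem dvd_and_dvd_of_sq_rel {p : ℕ} (hp : p.Prime) {t n u v t' d' : ℤ}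
    (hpD : ¬ (p : ℤ) ∣ t ^ 2 - 4 * n)
    (h1 : u ^ 2 - n * v ^ 2 - p * t' * u + p ^ 2 * d' = 0)
    (h2 : 2 * u * v + t * v ^ 2 - p * t' * v = 0) :
    (p : ℤ) ∣ u ∧ (p : ℤ) ∣ v := by
  have hpZ : Prime (p : ℤ) := Nat.prime_iff_prime_int.mp hp
  -- first `p ∣ v`
  have hv : (p : ℤ) ∣ v := by
    by_contra hv
    -- `v (2u + tv) = p t' v`, so `p ∣ 2u + tv`
    have h3 : (p : ℤ) ∣ v * (2 * u + t * v) := ⟨t' * v, by linear_combination h2⟩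
    obtain ⟨w, hw⟩ : (p : ℤ) ∣ 2 * u + t * v := (hpZ.dvd_or_dvd h3).resolve_left hv
    -- `(t² - 4n) v² = (tv)² - 4nv² = (pw - 2u)² - 4nv² ≡ 4(u² - nv²) ≡ 0 (mod p)`
    have h4 : (t ^ 2 - 4 * n) * v ^ 2 =
        p * (p * w ^ 2 - 4 * u * w + 4 * t' * u - 4 * p * d') := by
      linear_combination (t * v + p * w - 2 * u) * hw + 4 * h1
    have h5 : (p : ℤ) ∣ (t ^ 2 - 4 * n) * v ^ 2 := ⟨_, h4⟩
    rcases hpZ.dvd_or_dvd h5 with h6 | h6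
    · exact hpD h6
    · exact hv (hpZ.dvd_of_dvd_pow h6)
  -- then `p ∣ u²`
  obtain ⟨v', rfl⟩ := hv
  have h7 : (p : ℤ) ∣ u ^ 2 := ⟨n * p * v' ^ 2 + t' * u - p * d', by linear_combination h1⟩
  exact ⟨hpZ.dvd_of_dvd_pow h7, Dvd.intro _ rfl⟩

/-! ## `1, ω` are independent over `ℤ` in a commutative `End_{K̄}(E)` -/

/-- In the (characteristic-`0`) ring `End_{K̄}(E)` of an elliptic curve, assumed commutative, an
element `x` with `x² − tx + n = 0` and `t² − 4n < 0` is irrational: `a + bx = 0` with integers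
`a, b` forces `a = b = 0` (from `bx = −a` one gets `a² + abt + b²n = 0`, i.e.
`(2a + bt)² = b²(t² − 4n) ≤ 0`). [folklore] -/
theorem intCast_add_intCast_mul_eq_zero [W.IsElliptic]
    (hcomm : ∀ a b : W.geomEndRing, a * b = b * a) {x : W.geomEndRing} {t n : ℤ}
    (hx : x * x - (t : W.geomEndRing) * x + (n : W.geomEndRing) = 0) (hD : t ^ 2 - 4 * n < 0)
    {a b : ℤ} (h : (a : W.geomEndRing) + (b : W.geomEndRing) * x = 0) : a = 0 ∧ b = 0 := by
  haveI := charZero_geomEndRing W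
  letI : CommRing W.geomEndRing := { toRing := inferInstance, mul_comm := hcomm }
  -- `a² + abt + b²n = 0` in `ℤ`
  have hkey : ((a ^ 2 + a * b * t + b ^ 2 * n : ℤ) : W.geomEndRing) = 0 := by
    push_cast
    linear_combination (b : W.geomEndRing) ^ 2 * hx +
      ((a : W.geomEndRing) - (b : W.geomEndRing) * x + (b : W.geomEndRing) * t) * h
  have hZ : a ^ 2 + a * b * t + b ^ 2 * n = 0 := by exact_mod_cast hkey
  have hb : b = 0 := by
    by_contra hb
    have h1 : (2 * a + b * t) ^ 2 = b ^ 2 * (t ^ 2 - 4 * n) := by linear_combination 4 * hZ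
    have h2 : b ^ 2 * (t ^ 2 - 4 * n) < 0 := mul_neg_of_pos_of_neg (by positivity) hD
    nlinarith [sq_nonneg (2 * a + b * t)]
  subst hb
  simp only [Int.cast_zero, zero_mul, add_zero, Int.cast_eq_zero] at h
  exact ⟨h, rfl⟩

/-! ## The index argument in `End_{K̄}(E)` -/

/-- **`p γ ∈ ℤ[x]` forces `γ ∈ ℤ[x]` when `p ∤ disc ℤ[x]`.** In a commutative `End_{K̄}(E)`
(`E` elliptic), let `x² − tx + n = 0` with `t² − 4n < 0`, let `p` be a prime with
`p ∤ t² − 4n`, and suppose `p γ = u + v x` for some `γ ∈ End_{K̄}(E)` and integers `u, v`. Then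
`p ∣ u` and `p ∣ v`. Indeed `γ` satisfies an integral quadratic equation `γ² − t'γ + d' = 0`
(Silverman, *AEC*, Cor. III.6.3 / III.§9; the tree's `exists_int_quadratic_of_mem_geomEndRing`),
and comparing the coordinates of `(pγ)² = p t'(pγ) − p² d'` and of `(u + vx)²` on `1, x`
(`intCast_add_intCast_mul_eq_zero`) gives the congruences of `dvd_and_dvd_of_sq_rel`. (This is
the statement that the conductor of `ℤ[x]` in any over-order inside `End_{K̄}(E)` is prime to `p`;
Lang, *Elliptic Functions*, Ch. 13 §4, proof of Thm. 12(ii), PDF p. 141: *"`ℓ` cannot divide the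
conductor"*.) [folklore] -/
theorem dvd_and_dvd_of_natCast_mul_eq [W.IsElliptic]
    (hcomm : ∀ a b : W.geomEndRing, a * b = b * a) {x : W.geomEndRing} {t n : ℤ}
    (hx : x * x - (t : W.geomEndRing) * x + (n : W.geomEndRing) = 0) (hD : t ^ 2 - 4 * n < 0)
    {p : ℕ} (hp : p.Prime) (hpD : ¬ (p : ℤ) ∣ t ^ 2 - 4 * n)
    {γ : W.geomEndRing} {u v : ℤ}
    (hγ : (p : W.geomEndRing) * γ = (u : W.geomEndRing) + (v : W.geomEndRing) * x) :
    (p : ℤ) ∣ u ∧ (p : ℤ) ∣ v := by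
  haveI := charZero_geomEndRing W
  -- the integral quadratic equation of `γ`
  obtain ⟨t', d', hγq, -⟩ := exists_int_quadratic_of_mem_geomEndRing (W := W) γ.2
  have hγq' : γ * γ - (t' : W.geomEndRing) * γ + (d' : W.geomEndRing) = 0 := by
    apply Subtype.ext
    push_cast
    exact hγq
  letI : CommRing W.geomEndRing := { toRing := inferInstance, mul_comm := hcomm }
  -- `(u + vx)² - p t' (u + vx) + p² d' = 0`, expanded on `1, x`
  have hsq : ((u ^ 2 - n * v ^ 2 - p * t' * u + p ^ 2 * d' : ℤ) : W.geomEndRing) +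
      ((2 * u * v + t * v ^ 2 - p * t' * v : ℤ) : W.geomEndRing) * x = 0 := by
    push_cast
    linear_combination (p : W.geomEndRing) ^ 2 * hγq' - (v : W.geomEndRing) ^ 2 * hx -
      ((p : W.geomEndRing) * γ + (u : W.geomEndRing) + (v : W.geomEndRing) * x -
        (p : W.geomEndRing) * t') * hγ
  obtain ⟨h1, h2⟩ := intCast_add_intCast_mul_eq_zero hcomm hx hD hsq
  exact dvd_and_dvd_of_sq_rel hp hpD h1 h2

/-! ## Downstairs: the Frobenius is rational over `ℤ[ω]`, with denominator prime to `p` -/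

/-- **Deuring, downstairs: `m π ∈ ℤ[ω]` with `p ∤ m`.** Let `V` be an elliptic curve over `𝔽_p`,
`p` odd, and `ω ∈ End_{𝔽̄_p}(V)` with `ω² − dω + c = 0`, `d < 0`, `4c = d(d − 1)`, `p ∤ d` and `d`
a square modulo `p`. Then for the `p`-power Frobenius `π` there are `m ≥ 1` with `p ∤ m` and
integers `u, v` with `m π = u + v ω` in `End_{𝔽̄_p}(V)`. Proof: `V` is ordinary (Lang, *Elliptic
Functions*, Ch. 13 §4 Thm. 12, split case; the tree's `exists_ne_zero_nsmul_eq_zero_of_cmEnd`),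
so `End_{𝔽̄_p}(V)` is commutative and embeds in an imaginary quadratic field `k` (Lang, Ch. 13 §2
Thm. 5(i); `geomEndRing_comm_of_exists_torsion_char`,
`Lang1987_geomEndRing_isOrder_of_exists_pTorsion_holds`); there `1, ω` is a `ℚ`-basis (`ω ∉ ℚ`
as `d < 0`), so `m π = u + vω` for some `m ≥ 1`; the least such `m` is prime to `p` by
`dvd_and_dvd_of_natCast_mul_eq` (`p ∤ d = disc ℤ[ω]`). This is Lang, Ch. 13 §4 Thm. 13 with
Thm. 12(ii) (*"`End(Ā) = 𝔬₀ ∩ k`"*, *"`ℓ` cannot divide the conductor"*) in the form consumed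
upstairs. [cite: Lang1987, Ch. 13 §4 Thm. 12 and Thm. 13 (PDF pp. 140–142)] -/
theorem exists_natCast_mul_frobenius_eq_of_cmEnd {p : ℕ} [Fact p.Prime] (hp2 : p ≠ 2)
    (V : WeierstrassCurve (ZMod p)) [V.IsElliptic] {d c : ℤ} (hd : d < 0)
    (hc : d * (d - 1) = 4 * c) (hpd : ¬ (p : ℤ) ∣ d) (hsq : IsSquare ((d : ℤ) : ZMod p))
    (xω : V.geomEndRing)
    (hrel : xω * xω - (d : V.geomEndRing) * xω + (c : V.geomEndRing) = 0)
    {σ : Field.absoluteGaloisGroup (ZMod p)}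
    (hσ : ∀ x : AlgebraicClosure (ZMod p), σ • x = x ^ Nat.card (ZMod p)) :
    ∃ m : ℕ, 0 < m ∧ ¬ p ∣ m ∧ ∃ u v : ℤ,
      (m : V.geomEndRing) * ⟨(V.frobeniusIsogeny hσ).toAddMonoidHom,
          V.endRing_le_geomEndRing (V.frobeniusIsogeny hσ).toAddMonoidHom_mem_endRing⟩ =
        (u : V.geomEndRing) + (v : V.geomEndRing) * xω := by
  have hp : p.Prime := Fact.out
  haveI := charZero_geomEndRing V
  haveI := isDomain_geomEndRing V
  set xF : V.geomEndRing := ⟨(V.frobeniusIsogeny hσ).toAddMonoidHom,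
    V.endRing_le_geomEndRing (V.frobeniusIsogeny hσ).toAddMonoidHom_mem_endRing⟩ with hxF
  have hD : d ^ 2 - 4 * c = d := by linarith
  have hD' : d ^ 2 - 4 * c < 0 := by rw [hD]; exact hd
  have hpD' : ¬ (p : ℤ) ∣ d ^ 2 - 4 * c := by rw [hD]; exact hpd
  -- Step 1: `V` is ordinary
  have hrelE : (xω : AddMonoid.End V.geomPoints) * (xω : AddMonoid.End V.geomPoints) -
      (d : AddMonoid.End V.geomPoints) * (xω : AddMonoid.End V.geomPoints) +
      (c : AddMonoid.End V.geomPoints) = 0 := by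
    have h0 := congrArg (fun z : V.geomEndRing ↦ (z : AddMonoid.End V.geomPoints)) hrel
    simpa using h0
  have hT : ∃ P : V.geomPoints, P ≠ 0 ∧ p • P = 0 :=
    exists_ne_zero_nsmul_eq_zero_of_cmEnd p hp2 hd hc hpd hsq xω.2 hrelE
  have hcomm : ∀ a b : V.geomEndRing, a * b = b * a := fun a b ↦
    Subtype.ext (geomEndRing_comm_of_exists_torsion_char V p hT a.2 b.2)
  -- Step 2: `End_{𝔽̄_p}(V)` embeds in an imaginary quadratic field `k`
  have hT' : ∃ P : V.geomPoints, P ≠ 0 ∧ ringChar (ZMod p) • P = 0 := by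
    rwa [ZMod.ringChar_zmod_n]
  obtain ⟨k, _, _, ⟨hk2, _⟩, e, he, -⟩ := Lang1987_geomEndRing_isOrder_of_exists_pTorsion_holds V hT'
  set ι : V.geomEndRing →+* k := (algebraMap (𝓞 k) k).comp e with hι
  have hιinj : Function.Injective ι :=
    (NumberField.RingOfIntegers.coe_injective).comp he
  -- Step 3: `1, ι ω` is a `ℚ`-basis of `k`, so `m ι(π) = u + v ι(ω)` for some `m ≥ 1`
  set α : k := ι xω with hα
  set β : k := ι xF with hβ
  have hαrel : α * α - (d : k) * α + (c : k) = 0 := by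
    have h := congrArg ι hrel
    simpa [hα] using h
  have hαnot : ∀ q : ℚ, (q : k) ≠ α := by
    intro q hq
    have h1 : ((q * q - d * q + c : ℚ) : k) = 0 := by push_cast; rw [hq]; exact hαrel
    have h2 : q * q - d * q + c = 0 := by exact_mod_cast h1
    have h3 : ((2 * q - d) ^ 2 : ℚ) = (d ^ 2 - 4 * c : ℤ) := by
      push_cast; linear_combination 4 * h2
    have h4 : (0 : ℚ) ≤ (d ^ 2 - 4 * c : ℤ) := by rw [← h3]; positivity
    have h5 : (0 : ℤ) ≤ d ^ 2 - 4 * c := by exact_mod_cast h4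
    omega
  have hSome : ∃ m : ℕ, 0 < m ∧ ∃ u v : ℤ,
      (m : V.geomEndRing) * xF = (u : V.geomEndRing) + (v : V.geomEndRing) * xω := by
    -- a non-trivial `ℚ`-linear relation among `1, α, β`
    have hdep : ¬ LinearIndependent ℚ ![(1 : k), α, β] := by
      intro hli
      have := hli.fintype_card_le_finrank
      rw [Fintype.card_fin, hk2] at this
      omega
    obtain ⟨g, hg, i, hi⟩ := Fintype.not_linearIndependent_iff.mp hdep
    rw [Fin.sum_univ_three] at hg
    simp only [Matrix.cons_val_zero, Matrix.cons_val_one, Matrix.cons_val] at hg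
    rw [Rat.smul_def, Rat.smul_def, Rat.smul_def, mul_one] at hg
    change (g 0 : k) + (g 1 : k) * α + (g 2 : k) * β = 0 at hg
    have hg2 : g 2 ≠ 0 := by
      intro h0
      rw [h0, Rat.cast_zero, zero_mul, add_zero] at hg
      by_cases h1 : g 1 = 0
      · rw [h1, Rat.cast_zero, zero_mul, add_zero, Rat.cast_eq_zero] at hg
        fin_cases i
        · exact hi hg
        · exact hi h1
        · exact hi h0
      · apply hαnot (-(g 0) / g 1)
        have h1' : ((g 1 : ℚ) : k) ≠ 0 := by exact_mod_cast h1
        rw [Rat.cast_div, Rat.cast_neg, div_eq_iff h1']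
        linear_combination -hg
    -- `β = a₀ + a₁ α` with `a₀, a₁ ∈ ℚ`
    set a₀ : ℚ := -(g 0) / g 2 with ha₀
    set a₁ : ℚ := -(g 1) / g 2 with ha₁
    have hg2' : ((g 2 : ℚ) : k) ≠ 0 := by exact_mod_cast hg2
    have hβ' : β = (a₀ : k) + (a₁ : k) * α := by
      rw [ha₀, ha₁]
      push_cast
      field_simp
      linear_combination hg
    -- clear denominators
    have e0 : (a₀ : k) * (a₀.den : k) = (a₀.num : k) := by
      have := Rat.mul_den_eq_num a₀
      exact_mod_cast congrArg (fun q : ℚ ↦ (q : k)) this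
    have e1 : (a₁ : k) * (a₁.den : k) = (a₁.num : k) := by
      have := Rat.mul_den_eq_num a₁
      exact_mod_cast congrArg (fun q : ℚ ↦ (q : k)) this
    refine ⟨a₀.den * a₁.den, Nat.mul_pos a₀.den_pos a₁.den_pos, a₀.num * a₁.den,
      a₁.num * a₀.den, hιinj ?_⟩
    simp only [map_mul, map_add, map_natCast, map_intCast]
    rw [← hβ, ← hα, hβ']
    push_cast
    linear_combination ((a₁.den : k)) * e0 + ((a₀.den : k) * α) * e1
  -- Step 4: the least such `m` is prime to `p`
  obtain ⟨hm₀pos, u, v, huv⟩ := Nat.find_spec hSome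
  refine ⟨Nat.find hSome, hm₀pos, fun hpm ↦ ?_, u, v, huv⟩
  obtain ⟨m₁, hm₁⟩ := hpm
  have hm₁pos : 0 < m₁ := by
    rcases Nat.eq_zero_or_pos m₁ with h0 | h0
    · rw [h0, mul_zero] at hm₁; omega
    · exact h0
  -- `p (m₁ π) = u + v ω`, so `p ∣ u`, `p ∣ v`
  have hγ : (p : V.geomEndRing) * ((m₁ : V.geomEndRing) * xF) =
      (u : V.geomEndRing) + (v : V.geomEndRing) * xω := by
    rw [← mul_assoc, ← Nat.cast_mul, ← hm₁]; exact huv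
  obtain ⟨⟨u₁, rfl⟩, ⟨v₁, rfl⟩⟩ := dvd_and_dvd_of_natCast_mul_eq hcomm hrel hD' hp hpD' hγ
  -- cancel `p`: `m₁ π = u₁ + v₁ ω`, contradicting minimality
  have hp0 : (p : V.geomEndRing) ≠ 0 := by exact_mod_cast hp.ne_zero
  have hsmall : (m₁ : V.geomEndRing) * xF =
      (u₁ : V.geomEndRing) + (v₁ : V.geomEndRing) * xω := by
    apply mul_left_cancel₀ hp0
    rw [hγ]; push_cast
    rw [mul_add, ← mul_assoc]
  have hlt : m₁ < Nat.find hSome := by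
    rw [hm₁]; exact lt_mul_of_one_lt_left hm₁pos hp.one_lt
  exact Nat.find_min hSome hlt ⟨hm₁pos, u₁, v₁, hsmall⟩

end WeierstrassCurve

/-! ## Upstairs: an element of `ℤ[φ] ⊆ End_{ℚ̄}(E)` reducing to `m π` -/

namespace Literature.NumberTheory.EllipticCurves

open _root_.WeierstrassCurve

/-- **Deuring lifting at a split prime, for an arbitrary order `ℤ[φ] ⊆ End_{ℚ̄}(E)`.** Let `E/ℚ`
be given by a globally minimal `W`, let `φ ∈ End_{ℚ̄}(E)` satisfy `φ² − dφ + c = 0` with `d < 0`,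
`4c = d(d − 1)` (an order of discriminant `d`), and let `p ∤ Δ_W` be an odd prime of good reduction
with `p ∤ d` and `d` a square modulo `p` (`p` splits in `ℚ(√d)` and is prime to the conductor of
`ℤ[φ]`). Then there are `m ≥ 1` with `p ∤ m` and integers `u, v` such that `ρ = u + vφ`
**kills `E[m]`** and has **`#ker ρ = m² p`**. Proof: reduce modulo `p`
(`Lang1987_exists_reduction_geomPoints_geomEndRing_holds`, `exists_ringHom_geomEndRing_of_reduction`:
a ring homomorphism `r` compatible with the reduction `red` of points, degree-preserving);
`ω = r φ` satisfies the same equation, so `m π = u + v ω = r ρ`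
(`exists_natCast_mul_frobenius_eq_of_cmEnd`); for `P ∈ E[m]`,
`red (ρ P) = m π (red P) = π (red (mP)) = 0` and `ρ P ∈ E[m]`, on which `red` is injective
(Silverman, *AEC*, VII.3.1(b)); and `deg (m π) = m² p` (Cor. III.6.3, `deg π = p`) equals `#ker ρ`
by *AT* II.4.4. (Deuring 1941; Lang, *Elliptic Functions*, Ch. 13 §4, Thms. 12–13.)
[cite: Lang1987, Ch. 13 §4 Thm. 12 and Thm. 13 (PDF pp. 140–142)]
[cite: SilvermanAdvancedTopics1994, Prop. II.4.4] -/
theorem exists_cmEnd_apply_torsion_eq_zero_natCard_ker (W : WeierstrassCurve ℚ) [W.IsElliptic]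
    [W.IsGloballyMinimal] (xφ : W.geomEndRing) {d c : ℤ} (hd : d < 0) (hc : d * (d - 1) = 4 * c)
    (hrel : xφ * xφ - (d : W.geomEndRing) * xφ + (c : W.geomEndRing) = 0)
    (p : ℕ) [Fact p.Prime] (hp2 : p ≠ 2)
    (hΔ : ¬ (p : ℤ) ∣ WeierstrassCurve.minimalDiscriminantInt W) (hpd : ¬ (p : ℤ) ∣ d)
    (hsq : IsSquare ((d : ℤ) : ZMod p)) :
    ∃ (m : ℕ) (u v : ℤ), 0 < m ∧ ¬ p ∣ m ∧
      (∀ P : W.geomPoints, m • P = 0 →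
        (((u : W.geomEndRing) + (v : W.geomEndRing) * xφ : W.geomEndRing) :
          AddMonoid.End W.geomPoints) P = 0) ∧
      Nat.card (AddMonoidHom.ker ((((u : W.geomEndRing) + (v : W.geomEndRing) * xφ :
          W.geomEndRing) : AddMonoid.End W.geomPoints) : W.geomPoints →+ W.geomPoints)) =
        m ^ 2 * p := by
  have hp : p.Prime := Fact.out
  set V := reductionModPrime W p with hV
  haveI : V.IsElliptic := isElliptic_reductionModPrime W hΔ
  -- the reduction of points and of endomorphisms
  obtain ⟨red, hinj, hred⟩ := Lang1987_exists_reduction_geomPoints_geomEndRing_holds W p hΔ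
  obtain ⟨ℓ, hpℓ, hℓprime⟩ := Nat.exists_infinite_primes (p + 1)
  haveI : Fact ℓ.Prime := ⟨hℓprime⟩
  have hpl : ¬ p ∣ ℓ := fun hdvd ↦ by
    rcases (Nat.dvd_prime hℓprime).mp hdvd with h1 | h2
    · exact hp.one_lt.ne' h1
    · omega
  have hℓk : (ℓ : ZMod p) ≠ 0 := by
    rw [Ne, ZMod.natCast_eq_zero_iff]; exact hpl
  have hinj' : ∀ P ∈ WeierstrassCurve.geomPrimaryTorsion W ℓ, red P = 0 → P = 0 := fun P hP h0 ↦ by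
    obtain ⟨k, hk⟩ := (AddCommGroup.mem_primaryComponent).mp hP
    exact hinj (ℓ ^ k) (fun hdvd ↦ hpl (hp.dvd_of_dvd_pow hdvd)) P hk h0
  obtain ⟨r, hcompat, -, hdeg⟩ := exists_ringHom_geomEndRing_of_reduction red hℓk hinj' hred
  -- the Frobenius downstairs and `ω = r φ`
  obtain ⟨σ, hσ⟩ := WeierstrassCurve.exists_frobenius_absoluteGaloisGroup (ZMod p)
  set xF : V.geomEndRing := ⟨(V.frobeniusIsogeny hσ).toAddMonoidHom,
    V.endRing_le_geomEndRing (V.frobeniusIsogeny hσ).toAddMonoidHom_mem_endRing⟩ with hxF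
  have hrelV : r xφ * r xφ - (d : V.geomEndRing) * r xφ + (c : V.geomEndRing) = 0 := by
    have h := congrArg r hrel
    simpa using h
  obtain ⟨m, hmpos, hpm, u, v, huv⟩ :=
    V.exists_natCast_mul_frobenius_eq_of_cmEnd hp2 hd hc hpd hsq (r xφ) hrelV hσ
  rw [← hxF] at huv
  set xρ : W.geomEndRing := (u : W.geomEndRing) + (v : W.geomEndRing) * xφ with hxρ
  have hrρ : r xρ = (m : V.geomEndRing) * xF := by
    rw [hxρ, map_add, map_mul, map_intCast, map_intCast, huv]
  -- pointwise: `r xρ (red P) = m • σ • red P`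
  have hrρP : ∀ Q : V.geomPoints, ((r xρ : V.geomEndRing) : AddMonoid.End V.geomPoints) Q =
      m • (V.frobeniusIsogeny hσ) Q := by
    intro Q
    rw [hrρ]
    rfl
  refine ⟨m, u, v, hmpos, hpm, fun P hP ↦ ?_, ?_⟩
  · -- `ρ` kills `E[m]`
    have h1 : red (((xρ : W.geomEndRing) : AddMonoid.End W.geomPoints) P) = 0 := by
      rw [← hcompat xρ P, hrρP, ← map_nsmul, ← map_nsmul, hP, map_zero, map_zero]
    have h2 : m • (((xρ : W.geomEndRing) : AddMonoid.End W.geomPoints) P) = 0 := by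
      rw [← map_nsmul, hP, map_zero]
    exact hinj m hpm _ h2 h1
  · -- `#ker ρ = deg (m π) = m² p`
    set f : V.geomPoints →+ V.geomPoints := (m : ℤ) • (V.frobeniusIsogeny hσ).toAddMonoidHom
      with hf
    have hfm : f ∈ homModule V V :=
      Submodule.smul_mem _ _ (V.frobeniusIsogeny hσ).toAddMonoidHom_mem_homModule
    have h63 := degHom_isQuadraticForm_holds V V
    have hdegf : degHom V V f = (m : ℤ) ^ 2 * p := by
      rw [hf, degHom_zsmul h63 (V.frobeniusIsogeny hσ).toAddMonoidHom_mem_homModule,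
        degHom_toAddMonoidHom, V.frobeniusIsogeny_deg_eq_card_holds σ hσ, Nat.card_zmod]
    have hf0 : f ≠ 0 := fun h0 ↦ by
      rw [h0, degHom_zero] at hdegf
      have hm0 : (0 : ℤ) < m := by exact_mod_cast hmpos
      have hp0 : (0 : ℤ) < p := by exact_mod_cast hp.pos
      have : (0 : ℤ) < (m : ℤ) ^ 2 * p := mul_pos (pow_pos hm0 2) hp0
      linarith
    obtain ⟨μ, hμ⟩ := ((mem_homModule_iff_holds V V f).mp hfm).resolve_left hf0
    have hμdeg : (μ.deg : ℤ) = (m : ℤ) ^ 2 * p := by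
      rw [← degHom_toAddMonoidHom, hμ, hdegf]
    have hμr : (μ.toAddMonoidHom : AddMonoid.End V.geomPoints) = r xρ := by
      refine AddMonoidHom.ext fun Q ↦ ?_
      change μ.toAddMonoidHom Q = ((r xρ : V.geomEndRing) : AddMonoid.End V.geomPoints) Q
      rw [hrρP Q, hμ, hf, AddMonoidHom.smul_apply, natCast_zsmul]
      rfl
    have hker := hdeg xρ μ hμr
    have : (Nat.card (AddMonoidHom.ker (((xρ : W.geomEndRing) : AddMonoid.End W.geomPoints) :
        W.geomPoints →+ W.geomPoints)) : ℤ) = (m : ℤ) ^ 2 * p := by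
      rw [← hker, hμdeg]
    exact_mod_cast this

end Literature.NumberTheory.EllipticCurves

end
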